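import Mathlib
import Summits.Ventures.PercRepro2.WeightedRowInactive

/-!
# The weighted row (W-ROW-MIN) on `a₃`-inactive instances is a QUANTITATIVE «mixed BHK»
(blind cell PercRepro2, night-3 g20, 2026-08-28; `proofs/NIGHT3-CERT.md` §29)

The type-`1` twin of `WeightedRowInactive.lean`: with one typed edge `e` of type `1` the typed sum
of a separable kernel splits into the three placements of the OPEN copy (`weight3_one`,
`triSum_singleton_one_sep`), and when `a₃` is inactive (`wrow_one_of_a3Inactive`)

  `T₁ = 2 p_e (1 − p_e)² · [ q₁ · Φ₀₀ + q₀ · M ]`,   `M = Φ₀₁ + Φ₁₀` the mixed-BHK slack,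

so the whole one-edge Bernstein row of an `a₃`-inactive instance is, up to the factor `2`,
`(N₀, N₁, N₂, N₃) = (q₀ Φ₀₀, q₁ Φ₀₀ + q₀ M, q₀ Φ₁₁ + q₁ M, q₁ Φ₁₁)` in the five two-copy
quantities `q₀, q₁, Φ₀₀, Φ₁₁, M` (own exact control: 600 / 600 random instances, a3inact_min.py).
(W-ROW-MIN) there reads `q₁ Φ₀₀ + q₀ M ≥ min(q₀ Φ₀₀, q₁ Φ₁₁)`, which follows from

* **`QuantMixedBHK`** (CANDIDATE, a `def`, NOT claimed proved): `q₀ · M ≥ (q₀ − q₁) · min(Φ₀₀, Φ₁₁)`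
  (census 0 / 13,357 nonzero random instances, this seat), with BHK for the contraction and `Q`
  decreasing: **`wrowMin_of_a3Inactive_of_quantMixedBHK`**.

Own work; standard axioms.
-/

namespace Summit.Ventures.PercRepro2

open UnionCluster

namespace CovForm

/-! ## `K₃` with one typed edge of type `1` -/

section OneTypedOne

variable {V : Type*} {E : Type*} [Fintype E] [DecidableEq E] {R : Type*} [Field R]

/-- The three-copy weight with `e` open in exactly one copy is the sum of the three placements of
the open copy, each copy pinned at `e`. -/
lemma weight3_one (p : E → R) (e : E) (x y z : Config E) :
    (if openCount x y z e = 1 then weight p x * weight p y * weight p z else 0) =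
      p e * (1 - p e) * (1 - p e) * (weight (Function.update p e 1) x *
          (weight (Function.update p e 0) y * weight (Function.update p e 0) z)) +
        (1 - p e) * p e * (1 - p e) * (weight (Function.update p e 0) x *
          (weight (Function.update p e 1) y * weight (Function.update p e 0) z)) +
        (1 - p e) * (1 - p e) * p e * (weight (Function.update p e 0) x *
          (weight (Function.update p e 0) y * weight (Function.update p e 1) z)) := by
  rw [weight_eq_pin p x e, weight_eq_pin p y e, weight_eq_pin p z e]
  cases hxe : x e <;> cases hye : y e <;> cases hze : z e <;>
    simp only [openCount, hxe, hye, hze, Bool.toNat_true, Bool.toNat_false,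
      weight_update_one_of_eq_false, weight_update_zero_of_eq_true,
      mul_zero, zero_mul, add_zero, zero_add] <;> norm_num <;> ring

/-- **The one-typed-edge (type `1`) sum of a separable term**: the three placements of the open
copy. -/
theorem triSum_singleton_one_sep (p : E → R) (e : E) (τ : E → ℕ) (hτ : τ e = 1)
    (f g h : Config E → R) :
    triSum p {e} τ (fun x y z => f x * (g y * h z)) =
      p e * (1 - p e) * (1 - p e) * (expect (Function.update p e 1) f *
          (expect (Function.update p e 0) g * expect (Function.update p e 0) h)) +
        (1 - p e) * p e * (1 - p e) * (expect (Function.update p e 0) f *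
          (expect (Function.update p e 1) g * expect (Function.update p e 0) h)) +
        (1 - p e) * (1 - p e) * p e * (expect (Function.update p e 0) f *
          (expect (Function.update p e 0) g * expect (Function.update p e 1) h)) := by
  unfold triSum
  simp only [Finset.mem_singleton, forall_eq, hτ]
  have hsplit : ∀ x y z : Config E,
      (if openCount x y z e = 1 then weight p x * weight p y * weight p z * (f x * (g y * h z))
        else 0) =
      p e * (1 - p e) * (1 - p e) * (weight (Function.update p e 1) x *
          (weight (Function.update p e 0) y * weight (Function.update p e 0) z) *
          (f x * (g y * h z))) +
        (1 - p e) * p e * (1 - p e) * (weight (Function.update p e 0) x *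
          (weight (Function.update p e 1) y * weight (Function.update p e 0) z) *
          (f x * (g y * h z))) +
        (1 - p e) * (1 - p e) * p e * (weight (Function.update p e 0) x *
          (weight (Function.update p e 0) y * weight (Function.update p e 1) z) *
          (f x * (g y * h z))) := by
    intro x y z
    have hw := weight3_one p e x y z
    have hite : (if openCount x y z e = 1 then
        weight p x * weight p y * weight p z * (f x * (g y * h z)) else 0) =
        (if openCount x y z e = 1 then weight p x * weight p y * weight p z else 0) *
          (f x * (g y * h z)) := by
      split_ifs <;> simp
    rw [hite, hw]
    ring
  simp only [hsplit, Finset.sum_add_distrib, ← Finset.mul_sum]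
  simp only [expect]
  rw [sum3_sep, sum3_sep, sum3_sep]

end OneTypedOne

section InactiveMin

open A3Inactive

variable {V : Type*} {E : Type*} [Fintype E] [DecidableEq E] [Fintype V] [DecidableEq V]
  {R : Type*} [Field R] [LinearOrder R] [IsStrictOrderedRing R]

/-- **QUANTITATIVE MIXED BHK, a CANDIDATE (NOT claimed proved)**: `q₀ · M ≥ (q₀ − q₁) · min(Φ₀₀, Φ₁₁)`
— the mixed-BHK slack `M = Φ₀₁ + Φ₁₀` (the right side minus the left side of `MixedBHK`), weighted
by `q₀ = P⁰(Q)`, dominates the drop `q₀ − q₁` of `P(Q)` times the smaller of the two diagonal BHK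
slacks. Census (this seat, exact rationals): 0 failures on 13,357 nonzero random instances. With
BHK for the contraction and `Q` decreasing it gives (W-ROW-MIN) on `a₃`-inactive instances
(`wrowMin_of_a3Inactive_of_quantMixedBHK`). -/
def QuantMixedBHK (ends : E → Sym2 V) (o a₁ a₂ b : V) : Prop :=
  ∀ (p : E → R), IsProbVec p → ∀ e : E,
    (prob (Function.update p e 0) (avoidAll ends a₂ {a₁}) -
        prob (Function.update p e 1) (avoidAll ends a₂ {a₁})) *
      min ((prob (Function.update p e 0) (avoidAll ends a₂ {a₁} ∩ connEvent ends a₁ b) *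
              prob (Function.update p e 0) (avoidAll ends a₂ {a₁} ∩ connEvent ends a₂ o) -
            prob (Function.update p e 0) (avoidAll ends a₂ {a₁}) *
              prob (Function.update p e 0)
                (avoidAll ends a₂ {a₁} ∩ (connEvent ends a₂ o ∩ connEvent ends a₁ b))) +
           (prob (Function.update p e 0) (avoidAll ends a₂ {a₁} ∩ connEvent ends a₂ b) *
              prob (Function.update p e 0) (avoidAll ends a₂ {a₁} ∩ connEvent ends a₁ o) -
            prob (Function.update p e 0) (avoidAll ends a₂ {a₁}) *
              prob (Function.update p e 0)
                (avoidAll ends a₂ {a₁} ∩ (connEvent ends a₁ o ∩ connEvent ends a₂ b))))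
          ((prob (Function.update p e 1) (avoidAll ends a₂ {a₁} ∩ connEvent ends a₁ b) *
              prob (Function.update p e 1) (avoidAll ends a₂ {a₁} ∩ connEvent ends a₂ o) -
            prob (Function.update p e 1) (avoidAll ends a₂ {a₁}) *
              prob (Function.update p e 1)
                (avoidAll ends a₂ {a₁} ∩ (connEvent ends a₂ o ∩ connEvent ends a₁ b))) +
           (prob (Function.update p e 1) (avoidAll ends a₂ {a₁} ∩ connEvent ends a₂ b) *
              prob (Function.update p e 1) (avoidAll ends a₂ {a₁} ∩ connEvent ends a₁ o) -
            prob (Function.update p e 1) (avoidAll ends a₂ {a₁}) *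
              prob (Function.update p e 1)
                (avoidAll ends a₂ {a₁} ∩ (connEvent ends a₁ o ∩ connEvent ends a₂ b)))) ≤
      prob (Function.update p e 0) (avoidAll ends a₂ {a₁}) *
        ((prob (Function.update p e 0) (avoidAll ends a₂ {a₁} ∩ connEvent ends a₁ b) *
              prob (Function.update p e 1) (avoidAll ends a₂ {a₁} ∩ connEvent ends a₂ o) +
            prob (Function.update p e 1) (avoidAll ends a₂ {a₁} ∩ connEvent ends a₁ b) *
              prob (Function.update p e 0) (avoidAll ends a₂ {a₁} ∩ connEvent ends a₂ o) +
            prob (Function.update p e 0) (avoidAll ends a₂ {a₁} ∩ connEvent ends a₂ b) *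
              prob (Function.update p e 1) (avoidAll ends a₂ {a₁} ∩ connEvent ends a₁ o) +
            prob (Function.update p e 1) (avoidAll ends a₂ {a₁} ∩ connEvent ends a₂ b) *
              prob (Function.update p e 0) (avoidAll ends a₂ {a₁} ∩ connEvent ends a₁ o)) -
           (prob (Function.update p e 0) (avoidAll ends a₂ {a₁}) *
              prob (Function.update p e 1)
                (avoidAll ends a₂ {a₁} ∩ (connEvent ends a₂ o ∩ connEvent ends a₁ b)) +
            prob (Function.update p e 1) (avoidAll ends a₂ {a₁}) *
              prob (Function.update p e 0)
                (avoidAll ends a₂ {a₁} ∩ (connEvent ends a₂ o ∩ connEvent ends a₁ b)) +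
            prob (Function.update p e 0) (avoidAll ends a₂ {a₁}) *
              prob (Function.update p e 1)
                (avoidAll ends a₂ {a₁} ∩ (connEvent ends a₁ o ∩ connEvent ends a₂ b)) +
            prob (Function.update p e 1) (avoidAll ends a₂ {a₁}) *
              prob (Function.update p e 0)
                (avoidAll ends a₂ {a₁} ∩ (connEvent ends a₁ o ∩ connEvent ends a₂ b))))

omit [Fintype V] [DecidableEq V] in
/-- **The `a₃`-inactive type-`1` row identity**: `T₁ = 2 p_e (1 − p_e)² · [ q₁ · Φ₀₀ + q₀ · M ]`. -/
theorem wrow_one_of_a3Inactive (p : E → R) (e : E) (τ : E → ℕ) (hτ : τ e = 1)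
    (ends : E → Sym2 V) (o a₁ a₂ a₃ b : V)
    (h : ∀ ω : Config E, ¬ Conn ends ω a₁ a₃ ∧ ¬ Conn ends ω a₂ a₃) :
    triSum p {e} τ (K3 ends o a₁ a₂ a₃ b) =
      2 * (p e * (1 - p e) ^ 2) *
        (prob (Function.update p e 1) (avoidAll ends a₂ {a₁}) *
          ((prob (Function.update p e 0) (avoidAll ends a₂ {a₁} ∩ connEvent ends a₁ b) *
              prob (Function.update p e 0) (avoidAll ends a₂ {a₁} ∩ connEvent ends a₂ o) -
            prob (Function.update p e 0) (avoidAll ends a₂ {a₁}) *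
              prob (Function.update p e 0)
                (avoidAll ends a₂ {a₁} ∩ (connEvent ends a₂ o ∩ connEvent ends a₁ b))) +
           (prob (Function.update p e 0) (avoidAll ends a₂ {a₁} ∩ connEvent ends a₂ b) *
              prob (Function.update p e 0) (avoidAll ends a₂ {a₁} ∩ connEvent ends a₁ o) -
            prob (Function.update p e 0) (avoidAll ends a₂ {a₁}) *
              prob (Function.update p e 0)
                (avoidAll ends a₂ {a₁} ∩ (connEvent ends a₁ o ∩ connEvent ends a₂ b)))) +
         prob (Function.update p e 0) (avoidAll ends a₂ {a₁}) *
          ((prob (Function.update p e 0) (avoidAll ends a₂ {a₁} ∩ connEvent ends a₁ b) *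
              prob (Function.update p e 1) (avoidAll ends a₂ {a₁} ∩ connEvent ends a₂ o) +
            prob (Function.update p e 1) (avoidAll ends a₂ {a₁} ∩ connEvent ends a₁ b) *
              prob (Function.update p e 0) (avoidAll ends a₂ {a₁} ∩ connEvent ends a₂ o) +
            prob (Function.update p e 0) (avoidAll ends a₂ {a₁} ∩ connEvent ends a₂ b) *
              prob (Function.update p e 1) (avoidAll ends a₂ {a₁} ∩ connEvent ends a₁ o) +
            prob (Function.update p e 1) (avoidAll ends a₂ {a₁} ∩ connEvent ends a₂ b) *
              prob (Function.update p e 0) (avoidAll ends a₂ {a₁} ∩ connEvent ends a₁ o)) -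
           (prob (Function.update p e 0) (avoidAll ends a₂ {a₁}) *
              prob (Function.update p e 1)
                (avoidAll ends a₂ {a₁} ∩ (connEvent ends a₂ o ∩ connEvent ends a₁ b)) +
            prob (Function.update p e 1) (avoidAll ends a₂ {a₁}) *
              prob (Function.update p e 0)
                (avoidAll ends a₂ {a₁} ∩ (connEvent ends a₂ o ∩ connEvent ends a₁ b)) +
            prob (Function.update p e 0) (avoidAll ends a₂ {a₁}) *
              prob (Function.update p e 1)
                (avoidAll ends a₂ {a₁} ∩ (connEvent ends a₁ o ∩ connEvent ends a₂ b)) +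
            prob (Function.update p e 1) (avoidAll ends a₂ {a₁}) *
              prob (Function.update p e 0)
                (avoidAll ends a₂ {a₁} ∩ (connEvent ends a₁ o ∩ connEvent ends a₂ b))))) := by
  have hK : K3 (R := R) ends o a₁ a₂ a₃ b = fun x y z =>
      (iPD ends a₁ a₂ a₃ x : R) * (iQ ends a₁ a₂ y * f4 ends o a₁ a₂ b z) +
        iQ ends a₁ a₂ x * (f3 ends o a₁ a₂ a₃ y * f5 ends a₁ a₂ a₃ b z) -
        iPD ends a₁ a₂ a₃ x * (iQ ends a₁ a₂ y * f6 ends o a₁ a₂ a₃ b z) -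
        iPD ends a₁ a₂ a₃ x * (f7 ends a₁ a₂ b y * f7 ends a₁ a₂ o z) -
        f3 ends o a₁ a₂ a₃ x * (f7 ends a₁ a₂ b y * f7 ends a₁ a₂ a₃ z) +
        iPD ends a₁ a₂ a₃ x * (f7 ends a₁ a₂ b y * f10 ends o a₁ a₂ a₃ z) -
        iPD ends a₁ a₂ a₃ x * (iQ ends a₁ a₂ y * f11 ends o a₁ a₂ a₃ b z) +
        iQ ends a₁ a₂ x * (f12 ends a₁ a₂ a₃ b y * f3 ends o a₁ a₂ a₃ z) := by
    funext x y z
    exact K3_explicit ends o a₁ a₂ a₃ b x y z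
  rw [hK, triSum_add, triSum_sub, triSum_add, triSum_sub, triSum_sub, triSum_sub, triSum_add,
    triSum_singleton_one_sep p e τ hτ, triSum_singleton_one_sep p e τ hτ,
    triSum_singleton_one_sep p e τ hτ, triSum_singleton_one_sep p e τ hτ,
    triSum_singleton_one_sep p e τ hτ, triSum_singleton_one_sep p e τ hτ,
    triSum_singleton_one_sep p e τ hτ, triSum_singleton_one_sep p e τ hτ]
  rw [expect_f1 (Function.update p e 0) ends a₁ a₂,
    expect_f2 (Function.update p e 0) ends a₁ a₂ a₃,
    expect_f3 (Function.update p e 0) ends o a₁ a₂ a₃,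
    expect_f4 (Function.update p e 0) ends o a₁ a₂ b,
    expect_f5 (Function.update p e 0) ends a₁ a₂ a₃ b,
    expect_f6 (Function.update p e 0) ends o a₁ a₂ a₃ b,
    expect_f7 (Function.update p e 0) ends a₁ a₂ b,
    expect_f8 (Function.update p e 0) ends o a₁ a₂,
    expect_f9 (Function.update p e 0) ends a₁ a₂ a₃,
    expect_f10 (Function.update p e 0) ends o a₁ a₂ a₃,
    expect_f11 (Function.update p e 0) ends o a₁ a₂ a₃ b,
    expect_f12 (Function.update p e 0) ends a₁ a₂ a₃ b,
    expect_f1 (Function.update p e 1) ends a₁ a₂,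
    expect_f2 (Function.update p e 1) ends a₁ a₂ a₃,
    expect_f3 (Function.update p e 1) ends o a₁ a₂ a₃,
    expect_f4 (Function.update p e 1) ends o a₁ a₂ b,
    expect_f5 (Function.update p e 1) ends a₁ a₂ a₃ b,
    expect_f6 (Function.update p e 1) ends o a₁ a₂ a₃ b,
    expect_f7 (Function.update p e 1) ends a₁ a₂ b,
    expect_f8 (Function.update p e 1) ends o a₁ a₂,
    expect_f9 (Function.update p e 1) ends a₁ a₂ a₃,
    expect_f10 (Function.update p e 1) ends o a₁ a₂ a₃,
    expect_f11 (Function.update p e 1) ends o a₁ a₂ a₃ b,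
    expect_f12 (Function.update p e 1) ends a₁ a₂ a₃ b]
  unfold EQbo EQb3 EQb3o EQo EQ3 EQ3o PDb PDbo Do
  rw [gap_eq_Q, gap_eq_Q]
  simp only [TEvent_eq_empty h, TEvent'_eq_empty h, PDEvent_eq_Q h, Set.empty_inter, prob_empty]
  ring

/-- **(W-ROW-MIN) on `a₃`-inactive instances from quantitative mixed BHK**: at every edge `e` of
every instance with an inactive `a₃`, `T₁(p)` dominates `p_e (1 − p_e)²` times the cubic form of
the deletion or of the contraction — from `Q` decreasing, BHK06 Thm 1.4 for the contraction and
the candidate `QuantMixedBHK`. -/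
theorem wrowMin_of_a3Inactive_of_quantMixedBHK (ends : E → Sym2 V) (o a₁ a₂ a₃ b : V)
    (hq1 : QuantMixedBHK (R := R) ends o a₁ a₂ b)
    (h : ∀ ω : Config E, ¬ Conn ends ω a₁ a₃ ∧ ¬ Conn ends ω a₂ a₃)
    (p : E → R) (hp : IsProbVec p) (e : E) (τ : E → ℕ) (hτ : τ e = 1) :
    p e * (1 - p e) ^ 2 * Gc (Function.update p e 0) ends o a₁ a₂ a₃ b ≤
        triSum p {e} τ (K3 ends o a₁ a₂ a₃ b) ∨
      p e * (1 - p e) ^ 2 * Gc (Function.update p e 1) ends o a₁ a₂ a₃ b ≤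
        triSum p {e} τ (K3 ends o a₁ a₂ a₃ b) := by
  have hid := wrow_one_of_a3Inactive p e τ hτ ends o a₁ a₂ a₃ b h
  have hQ := hq1 p hp e
  have hq := prob_Q_update_one_le p hp ends a₁ a₂ e
  have hp1 : IsProbVec (Function.update p e 1) := hp.update e zero_le_one le_rfl
  have hp0 : IsProbVec (Function.update p e 0) := hp.update e le_rfl zero_le_one
  have hΦ1 := bLoH_mul_Q_le (Function.update p e 1) hp1 ends o a₁ a₂ b
  have hΦ2 := bHoL_mul_Q_le (Function.update p e 1) hp1 ends o a₁ a₂ b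
  have hQ1 := prob_nonneg hp1 (avoidAll ends a₂ {a₁})
  have hQ0 := prob_nonneg hp0 (avoidAll ends a₂ {a₁})
  have hc : 0 ≤ p e * (1 - p e) ^ 2 :=
    mul_nonneg (hp.nonneg e) (pow_nonneg (sub_nonneg.mpr (hp.le_one e)) 2)
  rw [Gc_eq_of_a3Inactive (Function.update p e 0) ends o a₁ a₂ a₃ b h,
    Gc_eq_of_a3Inactive (Function.update p e 1) ends o a₁ a₂ a₃ b h, hid]
  -- name the five two-copy quantities
  set q₀ := prob (Function.update p e 0) (avoidAll ends a₂ {a₁}) with hq₀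
  set q₁ := prob (Function.update p e 1) (avoidAll ends a₂ {a₁}) with hq₁
  set Φ₀₀ : R := ((prob (Function.update p e 0) (avoidAll ends a₂ {a₁} ∩ connEvent ends a₁ b) * prob (Function.update p e 0) (avoidAll ends a₂ {a₁} ∩ connEvent ends a₂ o) - prob (Function.update p e 0) (avoidAll ends a₂ {a₁}) * prob (Function.update p e 0) (avoidAll ends a₂ {a₁} ∩ (connEvent ends a₂ o ∩ connEvent ends a₁ b))) + (prob (Function.update p e 0) (avoidAll ends a₂ {a₁} ∩ connEvent ends a₂ b) * prob (Function.update p e 0) (avoidAll ends a₂ {a₁} ∩ connEvent ends a₁ o) - prob (Function.update p e 0) (avoidAll ends a₂ {a₁}) * prob (Function.update p e 0) (avoidAll ends a₂ {a₁} ∩ (connEvent ends a₁ o ∩ connEvent ends a₂ b)))) with hΦ₀₀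
  set Φ₁₁ : R := ((prob (Function.update p e 1) (avoidAll ends a₂ {a₁} ∩ connEvent ends a₁ b) * prob (Function.update p e 1) (avoidAll ends a₂ {a₁} ∩ connEvent ends a₂ o) - prob (Function.update p e 1) (avoidAll ends a₂ {a₁}) * prob (Function.update p e 1) (avoidAll ends a₂ {a₁} ∩ (connEvent ends a₂ o ∩ connEvent ends a₁ b))) + (prob (Function.update p e 1) (avoidAll ends a₂ {a₁} ∩ connEvent ends a₂ b) * prob (Function.update p e 1) (avoidAll ends a₂ {a₁} ∩ connEvent ends a₁ o) - prob (Function.update p e 1) (avoidAll ends a₂ {a₁}) * prob (Function.update p e 1) (avoidAll ends a₂ {a₁} ∩ (connEvent ends a₁ o ∩ connEvent ends a₂ b)))) with hΦ₁₁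
  set M : R := ((prob (Function.update p e 0) (avoidAll ends a₂ {a₁} ∩ connEvent ends a₁ b) *
              prob (Function.update p e 1) (avoidAll ends a₂ {a₁} ∩ connEvent ends a₂ o) +
            prob (Function.update p e 1) (avoidAll ends a₂ {a₁} ∩ connEvent ends a₁ b) *
              prob (Function.update p e 0) (avoidAll ends a₂ {a₁} ∩ connEvent ends a₂ o) +
            prob (Function.update p e 0) (avoidAll ends a₂ {a₁} ∩ connEvent ends a₂ b) *
              prob (Function.update p e 1) (avoidAll ends a₂ {a₁} ∩ connEvent ends a₁ o) +
            prob (Function.update p e 1) (avoidAll ends a₂ {a₁} ∩ connEvent ends a₂ b) *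
              prob (Function.update p e 0) (avoidAll ends a₂ {a₁} ∩ connEvent ends a₁ o)) -
           (prob (Function.update p e 0) (avoidAll ends a₂ {a₁}) *
              prob (Function.update p e 1)
                (avoidAll ends a₂ {a₁} ∩ (connEvent ends a₂ o ∩ connEvent ends a₁ b)) +
            prob (Function.update p e 1) (avoidAll ends a₂ {a₁}) *
              prob (Function.update p e 0)
                (avoidAll ends a₂ {a₁} ∩ (connEvent ends a₂ o ∩ connEvent ends a₁ b)) +
            prob (Function.update p e 0) (avoidAll ends a₂ {a₁}) *
              prob (Function.update p e 1)
                (avoidAll ends a₂ {a₁} ∩ (connEvent ends a₁ o ∩ connEvent ends a₂ b)) +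
            prob (Function.update p e 1) (avoidAll ends a₂ {a₁}) *
              prob (Function.update p e 0)
                (avoidAll ends a₂ {a₁} ∩ (connEvent ends a₁ o ∩ connEvent ends a₂ b)))) with hM
  have h2c : (0 : R) ≤ 2 * (p e * (1 - p e) ^ 2) := mul_nonneg (by norm_num) hc
  rcases le_or_gt Φ₀₀ Φ₁₁ with hle | hlt
  · left
    rw [min_eq_left hle] at hQ
    have key : q₀ * Φ₀₀ ≤ q₁ * Φ₀₀ + q₀ * M := by linear_combination hQ
    have h2 := mul_le_mul_of_nonneg_left key h2c
    linear_combination h2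
  · right
    rw [min_eq_right hlt.le] at hQ
    have hΦ : 0 ≤ Φ₁₁ := by linarith
    have hm : q₁ * Φ₁₁ ≤ q₁ * Φ₀₀ := mul_le_mul_of_nonneg_left hlt.le hQ1
    have hnn : 0 ≤ (q₀ - q₁) * Φ₁₁ := mul_nonneg (sub_nonneg.mpr hq) hΦ
    have key : q₁ * Φ₁₁ ≤ q₁ * Φ₀₀ + q₀ * M := by linarith
    have h2 := mul_le_mul_of_nonneg_left key h2c
    linear_combination h2

end InactiveMin

end CovForm

end Summit.Ventures.PercRepro2
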